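import Mathlib.Algebra.Polynomial.Coeff
import Mathlib.Algebra.Polynomial.Degree.Defs
import Mathlib.Data.Finset.Card
import Mathlib.Algebra.BigOperators.Ring.Finset

/-!
# Support item `AnchoredDoorHitsLowerPairs` (stmt-ValiantsHypothesis-22510), line `anchored-peeling`:
# TOP COEFFICIENT OF A CROSS VALUE — step 4 of the GAP-ONE recipe (blueprint HOME/val-np-p1/g19/QSTEP-BLUEPRINT addendum 2)

Helper file (`--supports stmt-ValiantsHypothesis-22510`; cell valiant-natproofs, rung V4, 𝒟-side door (c); registered line
`Cruxes/AnchoredDoorHitsLowerPairs/Lines/anchored_peeling.lean` v13; prover seat val-np-p1 gen 19). Definition-free, generic algebra. Closes NO item.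

In the gap-one UQ step the cross value is `Σ_{i,j} α_i · G′_{ij}(T) · β_j` with `α, β` cofactor vectors free of the specialisation variable `T` and entries
`G′_{ij}` of `T`-degree `≤ N` whose top coefficients are `[A ⊆ U_i] · [B ⊆ W_j] · r_{ij}` with `r = 1` at `(i_A, j_B)` (StarSpec entry formula). Choosing
`A = U_{i_A}` and `B = W_{j_B}` MAXIMAL in the supports of `α` and `β` leaves exactly one term.

* `coeff_sum_C_mul_mul_C` — `coeff_N (Σ_{i,j} C αᵢ · Gᵢⱼ · C βⱼ) = Σ_{i,j} αᵢ · coeff_N Gᵢⱼ · βⱼ`.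
* `sum_mul_indicator_mul_eq_single` — if `c i j = 0` unless `A ⊆ U i ∧ B ⊆ W j`, `α i ≠ 0 ∧ A ⊆ U i → i = i_A`, `β j ≠ 0 ∧ B ⊆ W j → j = j_B`, then
  `Σ_{i,j} α i · c i j · β j = α i_A · c i_A j_B · β j_B`.
* `cross_top_ne_zero` — the combination: the cross value is a nonzero polynomial as soon as `α i_A · c i_A j_B · β j_B ≠ 0`.

WHAT THIS IS NOT: no statement about the door; nothing on crux stmt-ValiantsHypothesis-14610 or on `VP` versus `VNP`.
-/

set_option linter.dupNamespace false

namespace Summit.ValiantsHypothesis.ValiantsHypothesis.Theorems.BarrierLever.AnchoredPeeling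

open Finset Polynomial

section TopCoeff

variable {R : Type*} [CommRing R] {ι κ : Type*} [Fintype ι] [Fintype κ]

/-- Coefficient extraction through a bilinear combination with constant coefficient vectors. -/
theorem coeff_sum_C_mul_mul_C (α : ι → R) (β : κ → R) (G : ι → κ → R[X]) (N : ℕ) :
    (∑ i, ∑ j, C (α i) * G i j * C (β j)).coeff N = ∑ i, ∑ j, α i * (G i j).coeff N * β j := by
  rw [finsetSum_coeff]
  refine Finset.sum_congr rfl (fun i _ => ?_)
  rw [finsetSum_coeff]
  refine Finset.sum_congr rfl (fun j _ => ?_)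
  rw [coeff_mul_C, coeff_C_mul]

/-- **One surviving term.** A double sum `Σ α i · c i j · β j` whose coefficients `c i j` vanish unless `A ⊆ U i` and `B ⊆ W j`, with `i_A` the only index
carrying `α i ≠ 0` and `A ⊆ U i`, and `j_B` the only index carrying `β j ≠ 0` and `B ⊆ W j`, equals its `(i_A, j_B)` term. -/
theorem sum_mul_indicator_mul_eq_single {X Y : Type*} (U : ι → Finset X) (W : κ → Finset Y) (A : Finset X) (B : Finset Y)
    (α : ι → R) (β : κ → R) (c : ι → κ → R)
    (hc : ∀ i j, ¬ (A ⊆ U i ∧ B ⊆ W j) → c i j = 0)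
    (i_A : ι) (hiA : ∀ i, α i ≠ 0 → A ⊆ U i → i = i_A)
    (j_B : κ) (hjB : ∀ j, β j ≠ 0 → B ⊆ W j → j = j_B) :
    ∑ i, ∑ j, α i * c i j * β j = α i_A * c i_A j_B * β j_B := by
  classical
  have hrow : ∀ i, i ≠ i_A → ∑ j, α i * c i j * β j = 0 := by
    intro i hi
    refine Finset.sum_eq_zero (fun j _ => ?_)
    by_cases hα : α i = 0
    · rw [hα, zero_mul, zero_mul]
    · have hA : ¬ A ⊆ U i := fun hA => hi (hiA i hα hA)
      rw [hc i j (fun h => hA h.1), mul_zero, zero_mul]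
  rw [Finset.sum_eq_single i_A (fun i _ hi => hrow i hi) (fun h => (h (Finset.mem_univ _)).elim)]
  refine Finset.sum_eq_single j_B (fun j _ hj => ?_) (fun h => (h (Finset.mem_univ _)).elim)
  by_cases hβ : β j = 0
  · rw [hβ, mul_zero]
  · have hB : ¬ B ⊆ W j := fun hB => hj (hjB j hβ hB)
    rw [hc i_A j (fun h => hB h.2), mul_zero, zero_mul]

/-- **The cross value is a nonzero polynomial.** If every `G i j` has `T`-degree `≤ N` with top coefficient supported on `A ⊆ U i ∧ B ⊆ W j`, the supports
of `α`, `β` above `A`, `B` are the single indices `i_A`, `j_B`, and `α i_A · coeff_N (G i_A j_B) · β j_B ≠ 0`, then `Σ C αᵢ · Gᵢⱼ · C βⱼ ≠ 0`. -/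
theorem cross_top_ne_zero {X Y : Type*} (U : ι → Finset X) (W : κ → Finset Y) (A : Finset X) (B : Finset Y)
    (α : ι → R) (β : κ → R) (G : ι → κ → R[X]) (N : ℕ)
    (htop : ∀ i j, ¬ (A ⊆ U i ∧ B ⊆ W j) → (G i j).coeff N = 0)
    (i_A : ι) (hiA : ∀ i, α i ≠ 0 → A ⊆ U i → i = i_A)
    (j_B : κ) (hjB : ∀ j, β j ≠ 0 → B ⊆ W j → j = j_B)
    (hne : α i_A * (G i_A j_B).coeff N * β j_B ≠ 0) :
    ∑ i, ∑ j, C (α i) * G i j * C (β j) ≠ 0 := by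
  intro h0
  have h := congrArg (fun f : R[X] => f.coeff N) h0
  simp only [coeff_zero] at h
  rw [coeff_sum_C_mul_mul_C, sum_mul_indicator_mul_eq_single U W A B α β (fun i j => (G i j).coeff N) htop i_A hiA j_B hjB] at h
  exact hne h

/-- **Maximal support elements exist and are unique above themselves.** For an injective face map `U` and a vector `α ≠ 0` there is an index `i_A` with
`α i_A ≠ 0` whose face is ⊆-maximal in the support: `α i ≠ 0 → U i_A ⊆ U i → i = i_A`. -/
theorem exists_maximal_support {X : Type*} (U : ι → Finset X) (hU : Function.Injective U) (α : ι → R) (hα : α ≠ 0) :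
    ∃ i_A, α i_A ≠ 0 ∧ ∀ i, α i ≠ 0 → U i_A ⊆ U i → i = i_A := by
  classical
  have hne : (Finset.univ.filter fun i => α i ≠ 0).Nonempty := by
    by_contra h
    rw [Finset.not_nonempty_iff_eq_empty, Finset.filter_eq_empty_iff] at h
    exact hα (funext fun i => not_not.mp (h (Finset.mem_univ i)))
  -- take a support index with a face of maximal cardinality
  obtain ⟨i_A, hiA, hmax⟩ := Finset.exists_max_image (Finset.univ.filter fun i => α i ≠ 0) (fun i => (U i).card) hne
  refine ⟨i_A, (Finset.mem_filter.mp hiA).2, fun i hi hsub => ?_⟩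
  have hcard : (U i).card ≤ (U i_A).card := hmax i (Finset.mem_filter.mpr ⟨Finset.mem_univ _, hi⟩)
  exact (hU (Finset.eq_of_subset_of_card_le hsub hcard)).symm

end TopCoeff

end Summit.ValiantsHypothesis.ValiantsHypothesis.Theorems.BarrierLever.AnchoredPeeling
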